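import Summits.CriticalPhenomena.PercolationContinuityZ3.Theorems.PercAnnulusCrossingIICGluedAnnuliExponential
import HarnessLib

/-!
# Glued annuli given the inside: a one-sided Markov-type bound for Kesten's IIC under `CU⁺_l` (lane RSW3, p1 gen 18)

builds on p205010 (kernel theorem, internal audit signed; external expert review pending) — NOT used in this file.

RSW3 lane (LANE 3 `prim-rsw3`), seat `prim-rsw3-p1` (gen 18).  Helper file (`--supports stmt-CriticalPhenomena-4575`);
no definitions, no sorries.  Memo `run/shared/lean/prim/rsw3/P1-QM.md` §31.6.

The conditional step of `…IICGluedAnnuliExponential` (robust bounds survive conditioning on a block) with the block `B = pairs of Λ(a−1)`: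

* `real_siteToBoundary_inter_inter_annulusUniq_ge` — every `d`, `p`, `CU⁺_l(c)`: for every event `D` determined by the pairs of `Λ(a−1)` and
  `n > la`: **`c·P_p({0 ↔ ∂ⁱⁿΛ(n)} ∩ D) ≤ P_p({0 ↔ ∂ⁱⁿΛ(n)} ∩ D ∩ U(a,la))`**;
* **`iicMeasure_real_inter_annulusUniq_ge`** — hence for every IIC measure `ν`: **`c·ν(D) ≤ ν(D ∩ U(a,la))` for EVERY cylinder `D` of `Λ(a−1)`**:
  whatever the IIC looks like inside `Λ(a−1)`, the annulus `R(a,la)` is glued with conditional `ν`-probability `≥ c` — a one-sided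
  Markov-type lower bound across scales (gen 9's ratio mixing `ν(E ∩ G) ≥ ϰ²ν(E)ν(G)` needs `G` far; here `G = U(a,la)` is ADJACENT to `D`).
References: H. Kesten, PTRF 73 (1986) §2; C. Garban, appendix to Schramm–Smirnov, Ann. Probab. 39 (2011), Lemma B.1.
-/

noncomputable section

namespace Summit.CriticalPhenomena.PercolationContinuityZ3.Theorems.Crossing

open MeasureTheory Filter Topology Literature.Probability.Percolation Literature.Probability.LatticeModels
open Literature.Probability.Percolation.DCT16
open Summit.CriticalPhenomena.PercolationContinuityZ3.Theorems.SurfaceTension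

variable {d : ℕ}

/-- **GLUING GIVEN THE INSIDE, AT FINITE `n`**: under `CU⁺_l(c)` (every `d`, `p`), for `a ≥ 1`, `la < n` and every measurable `D` determined by the
pairs of `Λ(a−1)`: `c·P({0 ↔ ∂ⁱⁿΛ(n)} ∩ D) ≤ P({0 ↔ ∂ⁱⁿΛ(n)} ∩ D ∩ U(a,la))` (the arm is increasing; `U(a,la)` reads only pairs off `Λ(a−1)`).
[cite: SchrammSmirnov2011, Appendix B, Lemma B.1] -/
theorem real_siteToBoundary_inter_inter_annulusUniq_ge (p : unitInterval) {l : ℕ} (hl : 2 ≤ l) {c : ℝ}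
    (hCU : ∀ a : ℕ, 1 ≤ a → ∀ E : Set (BondConfig (Site d)), IsUpperSet E → MeasurableSet E →
      c * (bondPercolation (zdGraph d) p).real E ≤ (bondPercolation (zdGraph d) p).real (E ∩
        {ω : BondConfig (Site d) | ∀ t ∈ innerBoundary (zdGraph d) (box d a), ∀ s ∈ innerBoundary (zdGraph d) (box d (l * a)),
        ∀ t' ∈ innerBoundary (zdGraph d) (box d a), ∀ s' ∈ innerBoundary (zdGraph d) (box d (l * a)),
        ω ∈ openConnIn (↑((box d (l * a) \ box d a) ∪ innerBoundary (zdGraph d) (box d a)) : Set (Site d)) t s →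
        ω ∈ openConnIn (↑((box d (l * a) \ box d a) ∪ innerBoundary (zdGraph d) (box d a)) : Set (Site d)) t' s' →
        ω ∈ openConnIn (↑((box d (l * a) \ box d a) ∪ innerBoundary (zdGraph d) (box d a)) : Set (Site d)) s s'}))
    {a n : ℕ} (ha : 1 ≤ a) {D : Set (BondConfig (Site d))} (hD : DeterminedBy D (↑((box d (a - 1)).sym2) : Set (Sym2 (Site d))))
    (hDm : MeasurableSet D) :
    c * (bondPercolation (zdGraph d) p).real (siteToBoundary d n ∩ D) ≤
      (bondPercolation (zdGraph d) p).real (siteToBoundary d n ∩ D ∩ {ω : BondConfig (Site d) | ∀ t ∈ innerBoundary (zdGraph d) (box d a), ∀ s ∈ innerBoundary (zdGraph d) (box d (l * a)),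
        ∀ t' ∈ innerBoundary (zdGraph d) (box d a), ∀ s' ∈ innerBoundary (zdGraph d) (box d (l * a)),
        ω ∈ openConnIn (↑((box d (l * a) \ box d a) ∪ innerBoundary (zdGraph d) (box d a)) : Set (Site d)) t s →
        ω ∈ openConnIn (↑((box d (l * a) \ box d a) ∪ innerBoundary (zdGraph d) (box d a)) : Set (Site d)) t' s' →
        ω ∈ openConnIn (↑((box d (l * a) \ box d a) ∪ innerBoundary (zdGraph d) (box d a)) : Set (Site d)) s s'}) := by
  have hUm : MeasurableSet {ω : BondConfig (Site d) | ∀ t ∈ innerBoundary (zdGraph d) (box d a), ∀ s ∈ innerBoundary (zdGraph d) (box d (l * a)),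
        ∀ t' ∈ innerBoundary (zdGraph d) (box d a), ∀ s' ∈ innerBoundary (zdGraph d) (box d (l * a)),
        ω ∈ openConnIn (↑((box d (l * a) \ box d a) ∪ innerBoundary (zdGraph d) (box d a)) : Set (Site d)) t s →
        ω ∈ openConnIn (↑((box d (l * a) \ box d a) ∪ innerBoundary (zdGraph d) (box d a)) : Set (Site d)) t' s' →
        ω ∈ openConnIn (↑((box d (l * a) \ box d a) ∪ innerBoundary (zdGraph d) (box d a)) : Set (Site d)) s s'} := measurableSet_of_isLocalEvent_holds (isLocalEvent_annulusUniq (d := d) (by nlinarith))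
  have hUdet := determinedBy_annulusUniq (d := d) a (l * a) (sym2_annulus_subset_compl_sym2_box (d := d) (K := a - 1) (by omega))
  have hdisj : Disjoint {e : Sym2 (Site d) | e ∉ (↑((box d (a - 1)).sym2) : Set (Sym2 (Site d)))} (↑((box d (a - 1)).sym2)) :=
    Set.disjoint_left.2 fun e he he' => he he'
  exact real_inter_inter_ge_of_robust p ((box d (a - 1)).sym2) hUm (fun ω ξ hξ => mem_iff_of_determinedBy_disjoint hUdet hdisj ω hξ)
    (fun E hE hEm => hCU a ha E hE hEm) (isUpperSet_siteToBoundary d n) (measurableSet_siteToBoundary d n) hD hDm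

/-- **GLUING GIVEN THE INSIDE, UNDER THE IIC**: under `CU⁺_l(c)` (every `d`, `p`), for every finite measure `ν` with Kesten's IIC limit property,
every `a ≥ 1` and every measurable `D` determined by the pairs of `Λ(a−1)`: **`c·ν(D) ≤ ν(D ∩ U(a,la))`** — conditionally on ANY cylinder event
of the inside, the annulus `R(a,la)` is glued with `ν`-probability `≥ c`. [cite: Kesten1986, §2] -/
theorem iicMeasure_real_inter_annulusUniq_ge (p : unitInterval) {l : ℕ} (hl : 2 ≤ l) {c : ℝ}
    (hCU : ∀ a : ℕ, 1 ≤ a → ∀ E : Set (BondConfig (Site d)), IsUpperSet E → MeasurableSet E →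
      c * (bondPercolation (zdGraph d) p).real E ≤ (bondPercolation (zdGraph d) p).real (E ∩
        {ω : BondConfig (Site d) | ∀ t ∈ innerBoundary (zdGraph d) (box d a), ∀ s ∈ innerBoundary (zdGraph d) (box d (l * a)),
        ∀ t' ∈ innerBoundary (zdGraph d) (box d a), ∀ s' ∈ innerBoundary (zdGraph d) (box d (l * a)),
        ω ∈ openConnIn (↑((box d (l * a) \ box d a) ∪ innerBoundary (zdGraph d) (box d a)) : Set (Site d)) t s →
        ω ∈ openConnIn (↑((box d (l * a) \ box d a) ∪ innerBoundary (zdGraph d) (box d a)) : Set (Site d)) t' s' →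
        ω ∈ openConnIn (↑((box d (l * a) \ box d a) ∪ innerBoundary (zdGraph d) (box d a)) : Set (Site d)) s s'}))
    {ν : Measure (BondConfig (Site d))} [IsFiniteMeasure ν]
    (hν : ∀ (F : Finset (Sym2 (Site d))) (E : Set (BondConfig (Site d))), MeasurableSet E → DeterminedBy E ↑F →
      Tendsto (fun n : ℕ => (bondPercolation (zdGraph d) p).real (E ∩ siteToBoundary d n) / oneArmProb d p n)
        atTop (𝓝 (ν.real E)))
    {a : ℕ} (ha : 1 ≤ a) {D : Set (BondConfig (Site d))} (hD : DeterminedBy D (↑((box d (a - 1)).sym2) : Set (Sym2 (Site d))))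
    (hDm : MeasurableSet D) :
    c * ν.real D ≤ ν.real (D ∩ {ω : BondConfig (Site d) | ∀ t ∈ innerBoundary (zdGraph d) (box d a), ∀ s ∈ innerBoundary (zdGraph d) (box d (l * a)),
        ∀ t' ∈ innerBoundary (zdGraph d) (box d a), ∀ s' ∈ innerBoundary (zdGraph d) (box d (l * a)),
        ω ∈ openConnIn (↑((box d (l * a) \ box d a) ∪ innerBoundary (zdGraph d) (box d a)) : Set (Site d)) t s →
        ω ∈ openConnIn (↑((box d (l * a) \ box d a) ∪ innerBoundary (zdGraph d) (box d a)) : Set (Site d)) t' s' →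
        ω ∈ openConnIn (↑((box d (l * a) \ box d a) ∪ innerBoundary (zdGraph d) (box d a)) : Set (Site d)) s s'}) := by
  set U : Set (BondConfig (Site d)) := {ω : BondConfig (Site d) | ∀ t ∈ innerBoundary (zdGraph d) (box d a), ∀ s ∈ innerBoundary (zdGraph d) (box d (l * a)),
        ∀ t' ∈ innerBoundary (zdGraph d) (box d a), ∀ s' ∈ innerBoundary (zdGraph d) (box d (l * a)),
        ω ∈ openConnIn (↑((box d (l * a) \ box d a) ∪ innerBoundary (zdGraph d) (box d a)) : Set (Site d)) t s →
        ω ∈ openConnIn (↑((box d (l * a) \ box d a) ∪ innerBoundary (zdGraph d) (box d a)) : Set (Site d)) t' s' →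
        ω ∈ openConnIn (↑((box d (l * a) \ box d a) ∪ innerBoundary (zdGraph d) (box d a)) : Set (Site d)) s s'} with hU
  have hDloc : IsLocalEvent D := ⟨_, hD⟩
  have hUloc : IsLocalEvent U := isLocalEvent_annulusUniq (d := d) (by nlinarith)
  have hT1 := tendsto_iicMeasure_of_isLocalEvent p hν hDloc
  have hT2 := tendsto_iicMeasure_of_isLocalEvent p hν (hDloc.inter hUloc)
  refine le_of_tendsto_of_tendsto (hT1.const_mul c) hT2 (Eventually.of_forall fun n => ?_)
  have h := real_siteToBoundary_inter_inter_annulusUniq_ge p hl hCU (n := n) ha hD hDm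
  show c * ((bondPercolation (zdGraph d) p).real (D ∩ siteToBoundary d n) / oneArmProb d p n) ≤
    (bondPercolation (zdGraph d) p).real (D ∩ U ∩ siteToBoundary d n) / oneArmProb d p n
  by_cases hπ : oneArmProb d p n = 0
  · simp only [hπ, div_zero, mul_zero, le_refl]
  · have hπpos : 0 < oneArmProb d p n := lt_of_le_of_ne (by unfold oneArmProb; exact measureReal_nonneg) (Ne.symm hπ)
    rw [← mul_div_assoc, div_le_div_iff_of_pos_right hπpos]
    have h1 : D ∩ siteToBoundary d n = siteToBoundary d n ∩ D := Set.inter_comm _ _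
    have h2 : D ∩ U ∩ siteToBoundary d n = siteToBoundary d n ∩ D ∩ U := by
      ext ω; simp only [Set.mem_inter_iff]; tauto
    rw [h1, h2]
    exact h

end Summit.CriticalPhenomena.PercolationContinuityZ3.Theorems.Crossing

end
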